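import Summits.QuantumFields.BalabanUV.T4Continuum.Support.SubstrateCovariantAveragingGauge

/-!
# SUBSTRATE — THE CONTOUR SYSTEM OF RECORD IS A PATH SYSTEM: Bałaban's contours `Γ_{y,x} ∪ [x, x + t·e_μ]`
# (`CovariantBlockAveraging.contour`, [Balaban1984PropagatorsI] (1.7)∕(1.18) shape) are bond paths from the block's base point `n·y`
# to the averaged bond, in every shift-compatible chart — hence the gauge law `Q_k(U^u) = 𝒰_coarse·Q_k(U)·𝒰_fine⁻¹` holds for
# Bałaban's covariant block averaging OF RECORD of a V1 gauge field (follower of `SubstrateCovariantAveragingGauge`)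

Cell `pub-balaban`, SUBSTRATE cell, seat `b2b-balaban-substrate-p1` (the V1 half of item S-Q; the adjoint identities are seat p3's).
Summits-side under the LEAN PLACEMENT RULE (cell library).  HONEST FRAMING: rung (B)+1 of the FINITE-VOLUME T⁴ programme — NOT infinite
volume, NOT a mass gap, NOT Clay; spine PROVED 0∕9.  Pure lattice bookkeeping (`ZMod` coordinates of corners and legs) + the algebra of
the dictionary; nothing of the audited papers is asserted.  HONEST DEPENDENCY (cell line, verbatim): continuum YM on T⁴ ⇐ BetaPertH ∧
nine spine estimates (0/9 proved); BetaPertH ⇐ (D1) ∧ (D4) ∧ CAP+tail; G-an2-4 gates asym, D1 and NE2/3/4.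

WHAT.
* §1 CORNER BOOKKEEPING of `CovariantBlockAveraging.corner` (the printed contour walks one coordinate at a time): `corner_zero` (start =
  the base point `up n M y`), `corner_succ` (walking the `m`-th leg moves the corner by `j_m·e_m`), `corner_last` (after all `d` legs the
  corner is the block point `bpt n M y j`).
* §2 In a SHIFT-COMPATIBLE chart `e` (`SubstrateGaugeCovariance.ShiftCompatible`): a straight `leg` of `s` bonds is a bond path
  (`isBondPath_leg`), the concatenated legs of the contour are a bond path through the corners (`isBondPath_flatMap_legs`), and
  **`isBondPath_contour`**: `contour n M y j μ t` is a bond path from `e⁻¹(n·y)` to `e⁻¹(bpt y j + t·e_μ)`; packaged as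
  **`isPathSystem_contour : IsPathSystem e (contour n M) (fun y => e⁻¹ (up n M y))`**.
* §3 CONSEQUENCES BY NAME (`SubstrateCovariantAveragingGauge.Qcov_transV_gaugeAct` ∕ `QcovOf_gaugeAct`): the gauge law of Bałaban's
  covariant block averaging OF RECORD of a gauge field, `Qcov n M (contour n M) (transV e ι (U^u)) = siteMul (ι∘u∘base) * Qcov n M
  (contour n M) (transV e ι U) * siteMul (ι∘u⁻¹)` (`Qcov_contour_gaugeAct`), and on the tower chart of record (`QcovOf_contour_gaugeAct`,
  chart `siteIdx P h`, shift-compatible by `shiftCompatible_siteIdx`).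
Imports `SubstrateCovariantAveragingGauge`; nothing existing is modified.
-/

noncomputable section

open scoped BigOperators Matrix Kronecker Matrix.Norms.L2Operator

namespace Summit.QuantumFields.BalabanUV.T4Continuum.SubstrateContourPaths

open Literature.MathematicalPhysics.QuantumFieldTheory.Balaban1983to89
open Literature.MathematicalPhysics.QuantumFieldTheory.Balaban1983to89.B5Prop11Plancherel (Tor unitVec fine)
open Literature.MathematicalPhysics.QuantumFieldTheory.Balaban1983to89.B5Block118 (bpt tstep up iota tstep_zero tstep_succ)
open Literature.MathematicalPhysics.QuantumFieldTheory.Balaban1983to89.B5G183RateUnitTower (lev lev_neZero)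
open Summit.QuantumFields.BalabanUV.T4Continuum.BlockMultiplication (siteMul)
open Summit.QuantumFields.BalabanUV.T4Continuum.CovariantBlockAveraging (leg corner contour ContourSystem Qcov)
open Summit.QuantumFields.BalabanUV.T4Continuum.SubstrateBackgroundTransporters
open Summit.QuantumFields.BalabanUV.T4Continuum.SubstrateGaugeCovariance (ShiftCompatible shiftCompatible_siteIdx gaugeMulInv)
open Summit.QuantumFields.BalabanUV.T4Continuum.SubstrateCovariantAveraging
open Summit.QuantumFields.BalabanUV.T4Continuum.SubstrateCovariantAveragingGauge

/-! ## §1 Corner bookkeeping -/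

section Corners

variable {d : ℕ} {n : ℕ} {M : Fin d → ℕ}

/-- [folklore] The zeroth corner of the contour is the block's base point `n·y`. -/
theorem corner_zero (y : Tor M) (jj : Fin d → Fin n) : corner n M y jj 0 = up n M y := by
  funext ν
  simp [corner]

/-- [folklore] Walking the `m`-th leg (`j_m` bonds in direction `m`) moves the corner: `corner m + j_m·e_m = corner (m + 1)`. -/
theorem corner_succ (y : Tor M) (jj : Fin d → Fin n) (m : Fin d) :
    corner n M y jj m + tstep (fine n M) m (jj m) = corner n M y jj (m + 1) := by
  funext ν
  simp only [corner, Pi.add_apply, tstep]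
  by_cases hν : ν = m
  · subst hν
    simp
  · have hne : (ν : ℕ) ≠ (m : ℕ) := fun h => hν (Fin.ext h)
    rw [if_neg hν, add_zero]
    by_cases hlt : (ν : ℕ) < (m : ℕ)
    · rw [if_pos hlt, if_pos (by omega)]
    · rw [if_neg hlt, if_neg (by omega)]

/-- [folklore] After all `d` legs the corner is the block point `bpt y j = n·y + j`. -/
theorem corner_last (y : Tor M) (jj : Fin d → Fin n) : corner n M y jj d = bpt n M y jj := by
  funext ν
  simp only [corner, bpt, iota, Pi.add_apply, if_pos ν.is_lt]

end Corners

/-! ## §2 Legs and contours are bond paths in a shift-compatible chart -/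

section Paths

variable {P : Params} {j : ℕ} {n : ℕ} [NeZero n] {M : Fin P.d → ℕ} [hM : ∀ μ, NeZero (M μ)]
variable {e : Site P j ≃ Tor (fine n M)}

/-- [folklore] Transporting the endpoints of a bond path along equalities. -/
theorem isBondPath_congr {N : Fin P.d → ℕ} {e' : Site P j ≃ Tor N} {Γ : List (Tor N × Fin P.d)} {x y x' y' : Site P j}
    (h : IsBondPath e' Γ x y) (hx : x = x') (hy : y = y') : IsBondPath e' Γ x' y' := by
  subst hx; subst hy; exact h

omit [NeZero n] hM in
/-- [folklore] In a shift-compatible chart, `e⁻¹(z + e_ν) = (e⁻¹ z) + e_ν` (the V1 shift). -/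
theorem symm_add_unitVec (he : ShiftCompatible e) (z : Tor (fine n M)) (ν : Fin P.d) : e.symm (z + unitVec (fine n M) ν) = (e.symm z).shift ν := by
  apply e.injective
  rw [Equiv.apply_symm_apply, he, Equiv.apply_symm_apply]

omit [NeZero n] hM in
/-- [folklore] **A STRAIGHT LEG IS A BOND PATH**: `leg n M ν z s` (the `s` bonds `⟨z + r·e_ν, z + (r+1)·e_ν⟩`) is a bond path from `e⁻¹ z` to
`e⁻¹ (z + s·e_ν)`. -/
theorem isBondPath_leg (he : ShiftCompatible e) (ν : Fin P.d) (z : Tor (fine n M)) (s : ℕ) :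
    IsBondPath e (leg n M ν z s) (e.symm z) (e.symm (z + tstep (fine n M) ν s)) := by
  induction s with
  | zero => rw [tstep_zero, add_zero]; exact IsBondPath.nil _
  | succ s ih =>
      have hleg : leg n M ν z (s + 1) = leg n M ν z s ++ [(z + tstep (fine n M) ν s, ν)] := by
        rw [leg, leg, List.range_succ, List.map_append, List.map_singleton]
      rw [hleg]
      refine IsBondPath.append ih ?_
      have h1 := IsBondPath.single (e := e) (e.symm (z + tstep (fine n M) ν s)) ν
      rw [Equiv.apply_symm_apply] at h1
      refine isBondPath_congr h1 rfl ?_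
      rw [← symm_add_unitVec he, tstep_succ, add_assoc]

omit [NeZero n] hM in
/-- [folklore] THE CONCATENATED LEGS through consecutive directions `m, m+1, …` are a bond path through the corners. -/
theorem isBondPath_flatMap_legs (he : ShiftCompatible e) (y : Tor M) (jj : Fin P.d → Fin n) :
    ∀ (L : List (Fin P.d)) (m : ℕ), (∀ i (hi : i < L.length), ((L.get ⟨i, hi⟩ : Fin P.d) : ℕ) = m + i) → m + L.length ≤ P.d →
      IsBondPath e (L.flatMap fun ν => leg n M ν (corner n M y jj ν) (jj ν)) (e.symm (corner n M y jj m))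
        (e.symm (corner n M y jj (m + L.length))) := by
  intro L
  induction L with
  | nil => intro m _ _; simpa using IsBondPath.nil (e := e) (e.symm (corner n M y jj m))
  | cons ν L ih =>
      intro m hget hlen
      have hν : (ν : ℕ) = m := by simpa using hget 0 (by simp)
      rw [List.flatMap_cons]
      refine IsBondPath.append (y := e.symm (corner n M y jj (m + 1))) ?_ ?_
      · have h := isBondPath_leg he ν (corner n M y jj ν) (jj ν)
        rw [corner_succ] at h
        refine isBondPath_congr h ?_ ?_
        · rw [hν]
        · rw [hν]
      · have h2 := ih (m + 1) (fun i hi => by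
          have := hget (i + 1) (by simpa using Nat.succ_lt_succ hi)
          simp only [List.get_eq_getElem, List.getElem_cons_succ] at this ⊢
          omega) (by simp at hlen ⊢; omega)
        refine isBondPath_congr h2 rfl ?_
        simp only [List.length_cons]
        rw [show m + 1 + L.length = m + (L.length + 1) by omega]

omit [NeZero n] hM in
/-- [folklore] **THE CONTOUR OF RECORD IS A BOND PATH** from the block's base point `e⁻¹(n·y)` to the source `e⁻¹(bpt y j + t·e_μ)` of the
averaged fine bond ([Balaban1984PropagatorsI] (1.7)∕(1.18) shape: `Γ_{y,x} ∪ [x, x + t e_μ]`). -/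
theorem isBondPath_contour (he : ShiftCompatible e) (y : Tor M) (jj : Fin P.d → Fin n) (μ : Fin P.d) (t : ℕ) :
    IsBondPath e (contour n M y jj μ t) (e.symm (up n M y)) (e.symm (bpt n M y jj + tstep (fine n M) μ t)) := by
  rw [contour]
  refine IsBondPath.append (y := e.symm (bpt n M y jj)) ?_ (isBondPath_leg he μ (bpt n M y jj) t)
  have h := isBondPath_flatMap_legs he y jj (List.finRange P.d) 0 (fun i hi => by simp) (by simp)
  rw [corner_zero] at h
  refine isBondPath_congr h rfl ?_
  rw [List.length_finRange, zero_add, corner_last]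

omit [NeZero n] hM in
/-- [folklore] **THE CONTOUR SYSTEM OF RECORD IS A PATH SYSTEM** with base points `e⁻¹(n·y)`. -/
theorem isPathSystem_contour (he : ShiftCompatible e) : IsPathSystem e (contour n M) (fun y => e.symm (up n M y)) :=
  fun y jj μ t => isBondPath_contour he y jj μ t

end Paths

/-! ## §3 The gauge law of Bałaban's covariant block averaging of record of a gauge field -/

section GaugeLaw

variable {P : Params} {j : ℕ} {n : ℕ} [NeZero n] {M : Fin P.d → ℕ} [hM : ∀ μ, NeZero (M μ)]
variable {e : Site P j ≃ Tor (fine n M)}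
variable {G : Type*} [GaugeGroup G] {o : Type*} [Fintype o] [DecidableEq o] (ι : G →* Matrix o o ℂ)

/-- [folklore] **`Q_k(U^u) = 𝒰_coarse · Q_k(U) · 𝒰_fine⁻¹` FOR THE CONTOUR SYSTEM OF RECORD**, in every shift-compatible chart. -/
theorem Qcov_contour_gaugeAct (he : ShiftCompatible e) (u : GaugeTransf P j G) (U : GaugeField P j G) :
    Qcov n M (contour n M) (transV e ι (GaugeField.gaugeAct u U)) =
      siteMul (coarseMul ι (fun y => e.symm (up n M y)) u) * Qcov n M (contour n M) (transV e ι U) * siteMul (gaugeMulInv e ι u) :=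
  Qcov_transV_gaugeAct ι (isPathSystem_contour he) u U

end GaugeLaw

section Tower

variable (P : Params) {G : Type*} [GaugeGroup G] {o : Type*} [Fintype o] [DecidableEq o] (ι : G →* Matrix o o ℂ)
variable {j k : ℕ} (h : j + k = P.K)

/-- [folklore] **THE GAUGE LAW OF `QcovOf` ALONG THE CONTOUR SYSTEM OF RECORD** on the tower chart `siteIdx P h` (shift-compatible by
`shiftCompatible_siteIdx`): Bałaban's covariant `k`-fold averaging of the V1 configuration `U^u` is the site-conjugate of that of `U`. -/
theorem QcovOf_contour_gaugeAct (u : GaugeTransf P j G) (U : GaugeField P j G) :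
    QcovOf P ι h (contour (lev P.L k) (unitMod P)) (GaugeField.gaugeAct u U) =
      siteMul (coarseMul ι (fun y => (siteIdx P h).symm (up (lev P.L k) (unitMod P) y)) u) *
        QcovOf P ι h (contour (lev P.L k) (unitMod P)) U * siteMul (gaugeMulInv (siteIdx P h) ι u) :=
  QcovOf_gaugeAct P ι h (isPathSystem_contour (shiftCompatible_siteIdx P h)) u U

end Tower

end Summit.QuantumFields.BalabanUV.T4Continuum.SubstrateContourPaths

end
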